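import Mathlib
import Literature.MathematicalPhysics.QuantumFieldTheory.Balaban1983to89.B12
import Literature.MathematicalPhysics.QuantumFieldTheory.Balaban1983to89.Step

/-!
# Bałaban, *Renormalization group approach to lattice gauge field theories. I* (CMP 109, 1987) —
# the inductive bound (1.18) AS TYPED IN `Step.SFHyp` delivers (0.25), and (0.29) on the large domains

Surge node T09.3, pass 2 (unit b2b-balaban-pv03, 2026-08-18).  A BINDING module (imports `B12` and `Step`;
neither is modified): the cell typed the inductive assumptions (1.1)–(1.22) of Theorem 3 once abstractly
(`B12.RunData.IndAss`, reader r2) and once concretely (`Step.SFHyp`, strategist f2, field `bound118` = (1.18)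
p. 263 verbatim: *"|𝐄^{(j)}(X, g_{j−1}, 𝐔, 𝐉)| ≤ E₀ exp(−κd_j(X))  (1.18)  for M ≥ M(κ), γ sufficiently small,
and for all configurations (𝐔, 𝐉) ∈ U^c_j(X, α₀, α₁)."*).  Here the concrete one is confronted with the §0
statements of Theorem 1 typed in `B12` (`Bound025Printed` = (0.25), `Bound029Printed` = (0.29)):

* `bound025_of_bound118` — at a configuration lying in ALL the spaces U^c_j(X, α₀, α₁) (p. 263 [15]: *"the
  action A_k(U) defined on the space U_k(ε₀), which is contained in all the spaces U^c_j(X, α₀, α₁)"*; *"In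
  particular the minimal configurations U_j satisfying the bound |∂U_j − 1| < ε₀ξ² with ε₀ sufficiently small,
  satisfy the above conditions."*) the clause (1.18) IS the bound (0.25) for the family X ↦ 𝐄^{(j)}(X, g, φ):
  the "inspection" half of the inclusion `IndAss k → Repr k` of `B12.thm1_of_thm3_fixedConsts` /
  `hInspect` of `B12.thm1_of_thm3_twoStage`, kernel-checked over f2's carrier (the containment itself is the
  hypothesis `hφ`, by name);
* `largeDomain_of_bound118`, `bound029Large_of_bound118` — the "second, simpler case" of §3 (p. 271–272
  [23–24]) for the ACTUAL tower terms: on the domains with d_j(X) ≥ (L^jη)^{−1}, η = L^{−k} ((1.2) p. 260),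
  (1.18) gives the irrelevance bound (0.29) with 4 + α = N (every N), O(1) = E₀·N!/(δκ)^N and rate (1 − δ)κ
  (`B12.largeDomain_bound`, `B12.bound029_of_025_large`).

What is NOT here: the small-domain terms (X ⊂ □̃²; §§3–5 of the paper) — the located hypothesis `hExtract` of
`B12.thm1_of_thm3_twoStage` (GAPS.md G-pv03-2).  Value = typed skeleton / DAG edge `Step.SFHyp ⟶ B12 §0`,
NOT summit progress.
-/

namespace Literature.MathematicalPhysics.QuantumFieldTheory.Balaban1983to89.B12LargeDomain

open Literature.MathematicalPhysics.QuantumFieldTheory.Balaban1983to89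
open Literature.MathematicalPhysics.QuantumFieldTheory.Balaban1983to89.Step

variable {P : Params} {G : Type*} [GaugeGroup G] {Φ 𝒢 : Type*}

/-- **(1.18) ⟹ (0.25), by inspection — kernel-checked over `Step.SFHyp`.**  For a tower satisfying the
inductive hypotheses at step `k`, a scale `1 ≤ j ≤ k`, a coupling `g ∈ [0, γ]` and a configuration `φ` lying in
every space U^c_j(X, α₀, α₁) (p. 263 [15], verbatim: *"the space U_k(ε₀), which is contained in all the spaces
U^c_j(X, α₀, α₁)"* — the containment is the hypothesis `hφ`), the family `X ↦ |𝐄^{(j)}(X, g, φ)|` satisfies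
(0.25) = `B12.Bound025Printed` with the constants `E₀`, `κ` of (1.18). [cite: Balaban1987RG1, (1.18) p.263 and (0.25) p.257] -/
theorem bound025_of_bound118 {T : SFTower P G Φ 𝒢} {c : SFConsts} {k j : ℕ} (h : SFHyp T c k)
    (hj1 : 1 ≤ j) (hjk : j ≤ k) {g : ℝ} (hg0 : 0 ≤ g) (hgγ : g ≤ c.γ) {φ : Φ}
    (hφ : ∀ X, φ ∈ T.space j X c.α₀ c.α₁) :
    B12.Bound025Printed (S := T.sys j) (fun X => ‖T.E j X g φ‖) c.E₀ c.κ := by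
  intro X
  dsimp only
  rw [abs_norm]
  exact h.bound118 j hj1 hjk X g φ hg0 hgγ (hφ X)

/-- (1.18) at one inhabited pair (X, φ) forces `E₀ ≥ 0` (|·| ≥ 0, exp > 0) — bookkeeping. [folklore] -/
theorem E₀_nonneg_of_bound118 {T : SFTower P G Φ 𝒢} {c : SFConsts} {k j : ℕ} (h : SFHyp T c k)
    (hj1 : 1 ≤ j) (hjk : j ≤ k) {g : ℝ} (hg0 : 0 ≤ g) (hgγ : g ≤ c.γ) (X : (T.sys j).Dom) {φ : Φ}
    (hφ : φ ∈ T.space j X c.α₀ c.α₁) : 0 ≤ c.E₀ := by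
  have hb := le_trans (norm_nonneg (T.E j X g φ)) (h.bound118 j hj1 hjk X g φ hg0 hgγ hφ)
  exact (mul_nonneg_iff_of_pos_right (Real.exp_pos _)).mp hb

/-- **The "second, simpler case" of §3 for the actual tower terms** (p. 271–272 [23–24], with p. 258 [10]):
under the inductive hypotheses at step `k`, for `1 ≤ j ≤ k`, `g ∈ [0, γ]`, `φ ∈ U^c_j(X, α₀, α₁)` and a domain
with `d_j(X) ≥ s^{−1}` (`s` = the ξ-scale unit L^jη > 0), for every `N` and every `δ > 0`:
`|𝐄^{(j)}(X, g, φ)| ≤ E₀ · (N!/(δκ)^N) · s^N · exp(−(1−δ)κ d_j(X))` (requires `κ > 0`).  Instance of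
`B12.largeDomain_bound`. [cite: Balaban1987RG1, pp.271–272 and (1.18) p.263] -/
theorem largeDomain_of_bound118 {T : SFTower P G Φ 𝒢} {c : SFConsts} {k j : ℕ} (h : SFHyp T c k)
    (hj1 : 1 ≤ j) (hjk : j ≤ k) {g : ℝ} (hg0 : 0 ≤ g) (hgγ : g ≤ c.γ) (X : (T.sys j).Dom) {φ : Φ}
    (hφ : φ ∈ T.space j X c.α₀ c.α₁) (hκ : 0 < c.κ) {δ s : ℝ} (hδ : 0 < δ) (hs : 0 < s)
    (hd : s⁻¹ ≤ (T.sys j).dj X) (N : ℕ) :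
    ‖T.E j X g φ‖ ≤ c.E₀ * ((N.factorial : ℝ) / (δ * c.κ) ^ N) * s ^ N * Real.exp (-((1 - δ) * c.κ) * (T.sys j).dj X) := by
  have hE₀ : 0 ≤ c.E₀ := E₀_nonneg_of_bound118 h hj1 hjk hg0 hgγ X hφ
  have hb : |‖T.E j X g φ‖| ≤ c.E₀ * Real.exp (-c.κ * (T.sys j).dj X) := by
    rw [abs_norm]; exact h.bound118 j hj1 hjk X g φ hg0 hgγ hφ
  have := B12.largeDomain_bound (E := ‖T.E j X g φ‖) (d := (T.sys j).dj X) N hb hE₀ hκ hδ hs hd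
  rwa [abs_norm] at this

/-- `0 < L^j η` with `η = L^{−k}` ((1.2) p. 260: η = L^{−k}, so L^jη = L^{j−k}, the ξ-scale unit seen from the
η-lattice), from `1 < L`. [cite: Balaban1987RG1, (1.2) p.260] -/
theorem scaleUnit_pos (P : Params) (j k : ℕ) : 0 < (P.L : ℝ) ^ j * P.eta k := by
  have hL : (0 : ℝ) < (P.L : ℝ) := by exact_mod_cast P.L_pos
  unfold Params.eta
  positivity

/-- **(1.18) ⟹ (0.29) ON THE LARGE DOMAINS, for the actual tower** (p. 258 [10] "the first exponential can be
bounded by an arbitrary positive power of L^jη, e.g. by (5!/κ⁵)(L^jη)⁵"; p. 272 [24] "Thus in both cases we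
have irrelevant terms"): under the inductive hypotheses at step `k`, for `1 ≤ j ≤ k`, `g ∈ [0, γ]` and a
configuration `φ` contained in all the spaces U^c_j(X, α₀, α₁) (p. 263), the family
`X ↦ |𝐄^{(j)}(X, g, φ)|` restricted to the domains with `d_j(X) ≥ (L^jη)^{−1}` (η = L^{−k}; zero elsewhere)
satisfies `B12.Bound029Printed` with exponent 4 + α = N, O(1) = E₀·N!/(δκ)^N and rate (1 − δ)κ, for every `N`
and every `δ > 0` (`κ > 0`).  The small-domain part is §§3–5 of the paper and is not derived (GAPS.md G-pv03-2). [cite: Balaban1987RG1, p.258, pp.271–272, (0.29) p.258] -/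
theorem bound029Large_of_bound118 {T : SFTower P G Φ 𝒢} {c : SFConsts} {k j : ℕ} (h : SFHyp T c k)
    (hj1 : 1 ≤ j) (hjk : j ≤ k) {g : ℝ} (hg0 : 0 ≤ g) (hgγ : g ≤ c.γ) {φ : Φ}
    (hφ : ∀ X, φ ∈ T.space j X c.α₀ c.α₁) (hκ : 0 < c.κ) {δ : ℝ} (hδ : 0 < δ) (N : ℕ)
    (large : (T.sys j).Dom → Prop) [DecidablePred large]
    (hlarge : ∀ X, large X → ((P.L : ℝ) ^ j * P.eta k)⁻¹ ≤ (T.sys j).dj X) :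
    B12.Bound029Printed (S := T.sys j) (fun X => if large X then ‖T.E j X g φ‖ else 0)
      (c.E₀ * ((N.factorial : ℝ) / (δ * c.κ) ^ N)) (P.L : ℝ) (P.eta k) ((N : ℝ) - 4) ((1 - δ) * c.κ) j :=
  B12.bound029_of_025_large large (fun X => ‖T.E j X g φ‖) c.E₀ c.κ δ (P.L : ℝ) (P.eta k) j N
    (bound025_of_bound118 h hj1 hjk hg0 hgγ hφ) hκ hδ (scaleUnit_pos P j k) hlarge

end Literature.MathematicalPhysics.QuantumFieldTheory.Balaban1983to89.B12LargeDomain
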